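import Mathlib
import Summits.ValiantsHypothesis.ValiantsHypothesis.Theorems.GrenetZeonHessianRankCodimTwoLatinTable
import Summits.ValiantsHypothesis.ValiantsHypothesis.Theorems.GrenetZeonHessianRankCodimTwoBorderPlane
import Summits.ValiantsHypothesis.ValiantsHypothesis.Theorems.GrenetZeonHessianRankCodimTwoBorderFrobeniusEval
import HarnessLib

/-!
# Crux `GrenetZeon.HessianRankCodimTwo` (stmt-ValiantsHypothesis-8061), line `good_plane`, ALL large `n`:
# table identity for the permanent of the bordered Latin point

Seat val-width-8061-p1 g2 (memo `Cruxes/HessianRankCodimTwo/BorderedLatinAllN.md`).  For the bordered Latin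
plane of `Theorems/…BorderDefs.lean` (core blocks of size `p`, border block of size `r`):

* `eval_perPoly_bordPoint_eq_mul_bordPhi` — **`per(bordPoint p r a) = (p!)³ r! · Φ(a)`** with
  `Φ = bordPhi ℤ p r = [y^{(p,p,p;r)}] ℓ_0^p ℓ_1^p ℓ_2^p ℓ_{none}^r`, hence
  `eval_perPoly_bordPoint_eq_zero_iff_bordPhi` — on the plane, `per = 0 ↔ Φ(a) = 0`.

Proof = the table identity of Theorem P (p4's engine `sum_perm_comp_eq_smul_sum`, file `…LatinTable`): the
weight `Π_j L_{blk j, blk σj}(a)` of a permutation `σ` depends only on the labelling `blk ∘ σ`; the sum over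
equi-fibred labellings is the generating-function coefficient (`coeff_prod_sum_C_mul_X_pow`, file
`…LatinFrobenius`), the fibre count is `(p!)³ r!`.  Also: fibre cardinalities of `bordBlk`
(`card_filter_bordBlk_some/none`), entries of the point as evaluated entry forms (`bordPoint_apply_eq_aeval`).
VP ≠ VNP is not moved by anything here.
-/

noncomputable section

open MvPolynomial Finset Equiv
open Literature.Computability.AlgebraicComplexity

-- single-conjunct layout `Summits/ValiantsHypothesis/ValiantsHypothesis`: duplicated namespace by design
set_option linter.dupNamespace false

namespace Summit.ValiantsHypothesis.ValiantsHypothesis.Theorems.GrenetZeonHessianRankCodimTwo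

variable {p r : ℕ}

/-! ### The blocks of `Fin (3p + r)` -/

/-- The core block `K` consists of the indices `K·p + s`, `s < p`. [folklore] -/
theorem filter_bordBlk_some_eq (hp : 0 < p) (K : Fin 3) :
    (univ.filter fun j : Fin (3 * p + r) => bordBlk p r j = some K) =
      univ.map ⟨fun s : Fin p => (⟨K.val * p + s.val, by have := K.isLt; have := s.isLt; nlinarith⟩ :
        Fin (3 * p + r)), fun s t hst => by
          apply Fin.ext
          have := congrArg Fin.val hst
          simp only at this
          omega⟩ := by
  ext j
  simp only [mem_filter, mem_univ, true_and, mem_map, Function.Embedding.coeFn_mk]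
  constructor
  · intro hj
    have hlt : j.val < 3 * p := by
      by_contra h
      simp [bordBlk, h] at hj
    rw [bordBlk_of_lt hp hlt, Option.some.injEq, Fin.ext_iff] at hj
    simp only at hj
    refine ⟨⟨j.val % p, Nat.mod_lt _ hp⟩, Fin.ext ?_⟩
    simp only
    have := Nat.div_add_mod j.val p
    rw [hj] at this
    linarith [Nat.mul_comm p K.val]
  · rintro ⟨s, rfl⟩
    have hlt : K.val * p + s.val < 3 * p := by have := K.isLt; have := s.isLt; nlinarith
    rw [bordBlk_of_lt hp (by exact hlt), Option.some.injEq, Fin.ext_iff]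
    simp only
    rw [show K.val * p + s.val = s.val + p * K.val by ring, Nat.add_mul_div_left _ _ hp,
      Nat.div_eq_of_lt s.isLt, zero_add]

/-- Each core block has exactly `p` indices. [folklore] -/
theorem card_filter_bordBlk_some (hp : 0 < p) (K : Fin 3) :
    #(univ.filter fun j : Fin (3 * p + r) => bordBlk p r j = some K) = p := by
  rw [filter_bordBlk_some_eq hp K, card_map, card_univ, Fintype.card_fin]

/-- The border block consists of the indices `3p + s`, `s < r`. [folklore] -/
theorem filter_bordBlk_none_eq :
    (univ.filter fun j : Fin (3 * p + r) => bordBlk p r j = none) =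
      univ.map ⟨fun s : Fin r => (⟨3 * p + s.val, by have := s.isLt; omega⟩ : Fin (3 * p + r)),
        fun s t hst => by
          apply Fin.ext
          have := congrArg Fin.val hst
          simp only at this
          omega⟩ := by
  ext j
  simp only [mem_filter, mem_univ, true_and, mem_map, Function.Embedding.coeFn_mk]
  constructor
  · intro hj
    have hge : ¬ j.val < 3 * p := by
      intro h
      rcases Nat.eq_zero_or_pos p with h0 | h0
      · omega
      · rw [bordBlk_of_lt h0 h] at hj
        exact Option.some_ne_none _ hj
    exact ⟨⟨j.val - 3 * p, by have := j.isLt; omega⟩, Fin.ext (by simp only; omega)⟩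
  · rintro ⟨s, rfl⟩
    simp [bordBlk]

/-- The border block has exactly `r` indices. [folklore] -/
theorem card_filter_bordBlk_none :
    #(univ.filter fun j : Fin (3 * p + r) => bordBlk p r j = none) = r := by
  rw [filter_bordBlk_none_eq, card_map, card_univ, Fintype.card_fin]

/-- Fibre cardinalities of the block map, all blocks at once. [folklore] -/
theorem card_filter_bordBlk_eq (hp : 0 < p) (K : Option (Fin 3)) :
    #(univ.filter fun j : Fin (3 * p + r) => bordBlk p r j = K) = bordNuPer p r K := by
  rcases K with _ | K
  · rw [card_filter_bordBlk_none, bordNuPer_apply_none]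
  · rw [card_filter_bordBlk_some hp, bordNuPer_apply_some]

/-- Fibre cardinalities of the block map (subtype form). [folklore] -/
theorem card_bordBlk_fiber (hp : 0 < p) (K : Option (Fin 3)) :
    Fintype.card {j : Fin (3 * p + r) // bordBlk p r j = K} = bordNuPer p r K := by
  rw [Fintype.card_subtype, card_filter_bordBlk_eq hp]

/-- `Π_j f(blk j) = (Π_K f(some K)^p) · f(none)^r`. [folklore] -/
theorem prod_comp_bordBlk_eq {M : Type*} [CommMonoid M] (hp : 0 < p) (f : Option (Fin 3) → M) :
    ∏ j : Fin (3 * p + r), f (bordBlk p r j) = (∏ K : Fin 3, f (some K) ^ p) * f none ^ r := by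
  rw [← Finset.prod_fiberwise' univ (bordBlk p r) f, Fintype.prod_option, mul_comm]
  congr 1
  · refine Fintype.prod_congr _ _ fun K => ?_
    rw [Finset.prod_const, card_filter_bordBlk_some hp]
  · rw [Finset.prod_const, card_filter_bordBlk_none]

/-! ### Entries of the point as evaluated entry forms -/

/-- `bordPoint p r a (i, j) = L_{blk i, blk j}(a)`. [folklore] -/
theorem bordPoint_apply_eq_aeval (a : Fin 3 → ℂ) (i j : Fin (3 * p + r)) :
    bordPoint p r a (i, j) = aeval a (bordEnt ℤ (bordBlk p r i) (bordBlk p r j)) := by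
  rw [bordPoint_apply, aeval_bordEnt]
  exact Finset.sum_congr rfl fun d _ => mul_comm _ _

/-- The permanent of the bordered Latin point as an evaluated integer polynomial. [folklore] -/
theorem eval_perPoly_bordPoint (a : Fin 3 → ℂ) :
    MvPolynomial.eval (bordPoint p r a) (perPoly (Fin (3 * p + r)) ℂ) =
      aeval a (∑ σ : Perm (Fin (3 * p + r)), ∏ i, bordEnt ℤ (bordBlk p r (σ i)) (bordBlk p r i)) := by
  rw [eval_perPoly, Matrix.permanent, map_sum]
  refine Finset.sum_congr rfl fun σ _ => ?_
  rw [map_prod]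
  refine Finset.prod_congr rfl fun i _ => ?_
  rw [Matrix.of_apply, bordPoint_apply_eq_aeval]

/-! ### The table identity -/

/-- The generating-function coefficient as a colouring sum with prescribed fibre cardinalities. [folklore] -/
theorem coeff_prod_bordRowForm_card {ι : Type*} [Fintype ι] [DecidableEq ι] (blk : ι → Option (Fin 3))
    (ν : Option (Fin 3) →₀ ℕ) :
    coeff ν (∏ i, bordRowForm ℤ (blk i)) =
      ∑ g ∈ univ.filter (fun g : ι → Option (Fin 3) => ∀ K, (univ.filter fun i => g i = K).card = ν K),
        ∏ i, bordEnt ℤ (blk i) (g i) := by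
  have h := coeff_prod_sum_C_mul_X_pow (A := MvPolynomial (Fin 3) ℤ)
    (fun i J => bordEnt ℤ (blk i) J) (fun _ => 1) ν
  simp only [pow_one] at h
  change coeff ν (∏ i, ∑ J, C (bordEnt ℤ (blk i) J) * X J) = _
  rw [h]
  refine Finset.sum_congr (Finset.filter_congr fun g _ => ?_) fun _ _ => rfl
  rw [Finsupp.ext_iff]
  refine forall_congr' fun K => ?_
  rw [Finsupp.finsetSum_apply, Finset.card_filter]
  simp only [Finsupp.single_apply]

/-- **Table identity for the permanent:** `Σ_σ Π_i L_{blk σi, blk i} = ((p!)³ r!) • Φ`. [folklore] -/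
theorem sum_perm_prod_bordEnt_eq_smul_bordPhi (hp : 0 < p) :
    (∑ σ : Perm (Fin (3 * p + r)), ∏ i, bordEnt ℤ (bordBlk p r (σ i)) (bordBlk p r i)) =
      (p.factorial ^ 3 * r.factorial) • bordPhi ℤ p r := by
  classical
  -- reindex: weight of `σ` is `Φ(blk ∘ σ⁻¹)` with `Φ u = Π_j L_{blk j, u j}`
  have h1 : ∀ σ : Perm (Fin (3 * p + r)),
      ∏ i, bordEnt ℤ (bordBlk p r (σ i)) (bordBlk p r i) =
        ∏ j, bordEnt ℤ (bordBlk p r j) (bordBlk p r (σ⁻¹ j)) := by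
    intro σ
    rw [← Equiv.prod_comp σ (fun j => bordEnt ℤ (bordBlk p r j) (bordBlk p r (σ⁻¹ j)))]
    refine Fintype.prod_congr _ _ fun i => ?_
    simp only [Perm.coe_inv, Equiv.symm_apply_apply]
  have h2 : ∑ σ : Perm (Fin (3 * p + r)), ∏ j, bordEnt ℤ (bordBlk p r j) (bordBlk p r (σ⁻¹ j)) =
      ∑ τ : Perm (Fin (3 * p + r)),
        (fun u : Fin (3 * p + r) → Option (Fin 3) => ∏ j, bordEnt ℤ (bordBlk p r j) (u j))
          (bordBlk p r ∘ τ) :=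
    Fintype.sum_equiv (Equiv.inv (Perm (Fin (3 * p + r)))) _ _ fun σ => rfl
  rw [Finset.sum_congr rfl fun σ _ => h1 σ, h2,
    sum_perm_comp_eq_smul_sum (bordBlk p r)
      (fun u : Fin (3 * p + r) → Option (Fin 3) => ∏ j, bordEnt ℤ (bordBlk p r j) (u j))]
  have hN : ∏ K : Option (Fin 3), (Fintype.card {j : Fin (3 * p + r) // bordBlk p r j = K}).factorial =
      p.factorial ^ 3 * r.factorial := by
    simp_rw [card_bordBlk_fiber hp]
    rw [Fintype.prod_option, bordNuPer_apply_none, mul_comm]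
    simp_rw [bordNuPer_apply_some]
    rw [Finset.prod_const, card_univ, Fintype.card_fin]
  rw [hN]
  congr 1
  -- generating-function side
  rw [bordPhi, ← prod_comp_bordBlk_eq hp (bordRowForm ℤ), coeff_prod_bordRowForm_card]
  refine Finset.sum_congr (Finset.filter_congr fun u _ => ?_) fun _ _ => rfl
  refine forall_congr' fun K => ?_
  rw [card_bordBlk_fiber hp, Fintype.card_subtype]

/-- **The permanent of the bordered Latin point is `(p!)³ r! · Φ(a)`.** [folklore] -/
theorem eval_perPoly_bordPoint_eq_mul_bordPhi (hp : 0 < p) (a : Fin 3 → ℂ) :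
    MvPolynomial.eval (bordPoint p r a) (perPoly (Fin (3 * p + r)) ℂ) =
      ((p.factorial ^ 3 * r.factorial : ℕ) : ℂ) * aeval a (bordPhi ℤ p r) := by
  rw [eval_perPoly_bordPoint, sum_perm_prod_bordEnt_eq_smul_bordPhi hp, map_nsmul, nsmul_eq_mul]

/-- On the bordered Latin plane the permanent vanishes iff `Φ(a) = 0`. [folklore] -/
theorem eval_perPoly_bordPoint_eq_zero_iff_bordPhi (hp : 0 < p) (a : Fin 3 → ℂ) :
    MvPolynomial.eval (bordPoint p r a) (perPoly (Fin (3 * p + r)) ℂ) = 0 ↔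
      aeval a (bordPhi ℤ p r) = 0 := by
  rw [eval_perPoly_bordPoint_eq_mul_bordPhi hp, mul_eq_zero, or_iff_right]
  exact_mod_cast mul_ne_zero (pow_ne_zero 3 (Nat.factorial_ne_zero p)) (Nat.factorial_ne_zero r)

end Summit.ValiantsHypothesis.ValiantsHypothesis.Theorems.GrenetZeonHessianRankCodimTwo
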